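import Summits.PneNP.PneNP.Theorems.BruckRyserSosSosBlindPlanesIdentities
import Summits.PneNP.PneNP.Theorems.BruckRyserSosSosBlindPlanesTemplateSum
import Literature.AlgebraicGeometry.RealAlgebraic.SemialgebraicTangent

/-!
# PneNP / BruckRyserSos — the degree-`d` moment problem of the plane system is semialgebraic in the order

Route `PneNP/BruckRyserSos`, crux stmt-PneNP-16761 (`SosBlindPlanes`), eighth file.

For a fixed degree `d` we write down a finite system of real constraints `GoodPt d x μ` in one
real parameter `x` (the order) and the finitely many entries of a table `μ` on the template grid
`Fin (d+1) × Fin (d+1)`: table invariance, `μ ∅ = 1`, the template row/column identities of file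
`…Identities` (the board size entering only through `V(x) = x² + x + 1`), and the HANKEL
POSITIVITY `Σ_{a,b} c_a c_b T_{a+b+1}(x, μ) ≥ 0` for all real `c`, where `T_{k+1}` (`traceVal`)
is the template-sum expression of file `…TemplateSum` for the trace of the `(k+1)`-st power of
the moment matrix. Every constraint is a polynomial (in)equality (`idPoly`, `traceP`, `hankelP`
with the evaluation lemmas `aeval_…`), so

* `isSemialgebraic_goodSet` — `W_d = {(x, μ) | GoodPt d x μ}` is semialgebraic, and
* `isSemialgebraic_feasSet` — so is its projection `F_d = {x | ∃ μ, GoodPt d x μ}` to the line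
  (the tree's Tarski–Seidenberg theorem, through `IsSemialgebraic.exists_sum_elim`);
* `eventually_const_of_isSemialgebraic` — a semialgebraic subset of the line is eventually
  constant along `x → +∞` (sign conditions on finitely many univariate polynomials).

References: Bochnak–Coste–Roy, *Real Algebraic Geometry* (1998), Thm. 2.2.1, Prop. 2.2.4,
Prop. 2.1.7; Basu–Pollack–Roy, *Algorithms in Real Algebraic Geometry* (2006), Thm. 2.76.
-/

set_option linter.dupNamespace false -- `Summit.PneNP.PneNP.…`: summit = sub-problem name (D-0017 single-conjunct layout)

noncomputable section

namespace Summit.PneNP.PneNP.Theorems.SosBlindPlanes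

open Finset Function MvPolynomial
open Literature.ModelTheory.ExponentialFields

/-! ### Sizes and variables attached to a degree -/

/-- Templates for degree `d`: configurations of the `(d+1) × (d+1)` grid. [folklore] -/
abbrev Tmpl (d : ℕ) : Type := Finset (Fin (d + 1) × Fin (d + 1))

/-- Variables of the transfer formula: the order `x` and one real per template. [folklore] -/
abbrev Var (d : ℕ) : Type := Unit ⊕ Tmpl d

/-- The number of template pairs of the degree-`⌊d/2⌋` moment matrix. [folklore] -/
def K₁ (d : ℕ) : ℕ := Fintype.card (Idx (d + 1) (d / 2) × Idx (d + 1) (d / 2))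

/-- The size of the template board used for traces: `2 K₁ ⌊d/2⌋ + 1`. [folklore] -/
def Nsos (d : ℕ) : ℕ := 2 * K₁ d * (d / 2) + 1

/-- `0 < Nsos d`. [folklore] -/
theorem Nsos_pos (d : ℕ) : 0 < Nsos d := Nat.succ_pos _

/-! ### The real constraints -/
/-- The board size as a function of the order: `V(x) = x² + x + 1`. [folklore] -/
def Vr (x : ℝ) : ℝ := x ^ 2 + x + 1

/-- The coefficient `r_k(x)` of a template identity: `x + 1` for `k = 1`, `1` otherwise.
[folklore] -/
def rcoef (k : ℕ) (x : ℝ) : ℝ := if k = 1 then x + 1 else 1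

/-- Shrinking a configuration of the trace board to the template grid. [folklore] -/
def shrink (d : ℕ) (W : Finset (Fin (Nsos d) × Fin (Nsos d))) : Tmpl d :=
  canon (d + 1) W

/-- The table value of a closed walk of template configurations. [folklore] -/
def walkVal (d : ℕ) (μ : Tmpl d → ℝ) (k : ℕ) (ω : Fin (k + 2) → Idx (Nsos d) (d / 2)) : ℝ :=
  ∏ i : Fin (k + 1), μ (shrink d ((ω i.castSucc).1 ∪ (ω i.succ).1))

/-- "`C(V(x), a)`": the binomial coefficient of the board size as a polynomial in the order.
[folklore] -/
def chooseR (x : ℝ) (a : ℕ) : ℝ := (descPochhammer ℝ a).eval (Vr x) * (a.factorial : ℝ)⁻¹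

/-- The weight of a template tuple as a function of the order. [folklore] -/
def weightR (d : ℕ) (x : ℝ) (a b : ℕ) : ℝ :=
  (chooseR x a * (((Nsos d).choose a : ℝ))⁻¹) * (chooseR x b * (((Nsos d).choose b : ℝ))⁻¹)

/-- `T_{k+1}(x, μ)`: the template-sum expression for the trace of the `(k+1)`-st power of the
moment matrix. [folklore] -/
def traceVal (d k : ℕ) (x : ℝ) (μ : Tmpl d → ℝ) : ℝ :=
  ∑ ω : Fin (k + 2) → Idx (Nsos d) (d / 2),
    (if ω 0 = ω (Fin.last (k + 1)) then walkVal d μ k ω else 0) *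
      weightR d x (suppP ω).card (suppL ω).card

/-- The Hankel form `Σ_{a,b} c_a c_b T_{a+b+1}(x, μ)`. [folklore] -/
def hankelVal (d : ℕ) (x : ℝ) (μ : Tmpl d → ℝ) (c : Fin (K₁ d) → ℝ) : ℝ :=
  ∑ a : Fin (K₁ d), ∑ b : Fin (K₁ d), c a * c b * traceVal d (a + b) x μ

/-- **The constraints of the transfer formula** at order `x` for a table `μ`: invariance,
normalisation, the four families of template identities, and Hankel positivity. [folklore] -/
def GoodPt (d : ℕ) (x : ℝ) (μ : Tmpl d → ℝ) : Prop :=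
  TabInv μ ∧ μ ∅ = 1 ∧
    RowIdentity (d + 1) (Vr x) (d - 1) 1 (rcoef 1 x) μ ∧
    RowIdentity (d + 1) (Vr x) (d - 2) 2 (rcoef 2 x) μ ∧
    RowIdentity (d + 1) (Vr x) (d - 1) 1 (rcoef 1 x) (fun W => μ (swapC W)) ∧
    RowIdentity (d + 1) (Vr x) (d - 2) 2 (rcoef 2 x) (fun W => μ (swapC W)) ∧
    ∀ c : Fin (K₁ d) → ℝ, 0 ≤ hankelVal d x μ c

/-- Reading a point of the formula space: the order. [folklore] -/
def ordOf (d : ℕ) (w : Var d → ℝ) : ℝ := w (Sum.inl ())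

/-- Reading a point of the formula space: the table. [folklore] -/
def tabOf (d : ℕ) (w : Var d → ℝ) : Tmpl d → ℝ := fun τ => w (Sum.inr τ)

/-- Reading the order of a point given in blocks. [folklore] -/
@[simp] theorem ordOf_sumElim {d : ℕ} (z : Unit → ℝ) (y : Tmpl d → ℝ) :
    ordOf d (Sum.elim z y) = z () := rfl

/-- Reading the table of a point given in blocks. [folklore] -/
@[simp] theorem tabOf_sumElim {d : ℕ} (z : Unit → ℝ) (y : Tmpl d → ℝ) :
    tabOf d (Sum.elim z y) = y := rfl

/-- `W_d`: the points of the formula space satisfying the constraints. [folklore] -/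
def goodSet (d : ℕ) : Set (Var d → ℝ) :=
  {w | GoodPt d (ordOf d w) (tabOf d w)}

/-- `F_d`: the orders at which some table satisfies the constraints. [folklore] -/
def feasSet (d : ℕ) : Set (Unit → ℝ) :=
  {z | ∃ y : Tmpl d → ℝ, Sum.elim z y ∈ goodSet d}

/-- Membership in `F_d`. [folklore] -/
theorem mem_feasSet_iff {d : ℕ} (z : Unit → ℝ) :
    z ∈ feasSet d ↔ ∃ μ : Tmpl d → ℝ, GoodPt d (z ()) μ := by
  simp [feasSet, goodSet]

/-! ### The constraints as polynomials -/

section Polys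

variable (d : ℕ)

/-- The order variable. [folklore] -/
def xv : MvPolynomial (Var d) ℝ := X (Sum.inl ())

/-- The table variable of a template. [folklore] -/
def tv (τ : Tmpl d) : MvPolynomial (Var d) ℝ := X (Sum.inr τ)

/-- `V(x)` as a polynomial. [folklore] -/
def Vpoly : MvPolynomial (Var d) ℝ := xv d ^ 2 + xv d + 1

variable {d}

/-- Real scalars act trivially. [folklore] -/
theorem algebraMap_real_apply (r : ℝ) : algebraMap ℝ ℝ r = r := rfl

/-- Evaluating the order variable. [folklore] -/
@[simp] theorem aeval_xv (w : Var d → ℝ) : aeval w (xv d) = ordOf d w := by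
  rw [xv, aeval_X, ordOf]

/-- Evaluating a table variable. [folklore] -/
@[simp] theorem aeval_tv (w : Var d → ℝ) (τ : Tmpl d) : aeval w (tv d τ) = tabOf d w τ := by
  rw [tv, aeval_X, tabOf]

/-- Evaluating `V`. [folklore] -/
@[simp] theorem aeval_Vpoly (w : Var d → ℝ) : aeval w (Vpoly d) = Vr (ordOf d w) := by
  simp only [Vpoly, Vr, map_add, map_pow, map_one, aeval_xv]

variable (d)

/-- The polynomial of a template row identity (`col = false`) or column identity (`col = true`,
templates transposed): its vanishing at `(x, μ)` is the identity. [folklore] -/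
def idPoly (col : Bool) (k : ℕ) (τ₀ : Tmpl d) (A₀ : Finset (Fin (d + 1))) (Bs : Fin (d + 1)) :
    MvPolynomial (Var d) ℝ :=
  (∑ B₀ ∈ lns τ₀, tv d (if col then swapC (addLine τ₀ A₀ B₀) else addLine τ₀ A₀ B₀)) +
    (Vpoly d - C ((lns τ₀).card : ℝ)) *
      tv d (if col then swapC (addLine τ₀ A₀ Bs) else addLine τ₀ A₀ Bs) -
    (if k = 1 then xv d + 1 else 1) * tv d (if col then swapC τ₀ else τ₀)

variable {d}

/-- Evaluating the identity polynomial. [folklore] -/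
theorem aeval_idPoly (col : Bool) (k : ℕ) (τ₀ : Tmpl d) (A₀ : Finset (Fin (d + 1)))
    (Bs : Fin (d + 1)) (w : Var d → ℝ) :
    aeval w (idPoly d col k τ₀ A₀ Bs) =
      (∑ B₀ ∈ lns τ₀, tabOf d w (if col then swapC (addLine τ₀ A₀ B₀) else addLine τ₀ A₀ B₀)) +
        (Vr (ordOf d w) - (lns τ₀).card) *
          tabOf d w (if col then swapC (addLine τ₀ A₀ Bs) else addLine τ₀ A₀ Bs) -
        rcoef k (ordOf d w) * tabOf d w (if col then swapC τ₀ else τ₀) := by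
  have hr : aeval w (if k = 1 then xv d + 1 else 1) = rcoef k (ordOf d w) := by
    unfold rcoef
    split_ifs <;> simp only [map_add, map_one, aeval_xv]
  simp only [idPoly, map_sub, map_add, map_mul, map_sum, aeval_tv, aeval_Vpoly, aeval_C,
    algebraMap_real_apply, hr]

variable (d)

/-- `C(V(x), a)` as a polynomial. [folklore] -/
def chooseP (a : ℕ) : MvPolynomial (Var d) ℝ :=
  Polynomial.aeval (Vpoly d) (descPochhammer ℝ a) * C ((a.factorial : ℝ)⁻¹)

/-- The weight of a template tuple as a polynomial. [folklore] -/
def weightP (a b : ℕ) : MvPolynomial (Var d) ℝ :=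
  (chooseP d a * C ((((Nsos d).choose a : ℝ))⁻¹)) * (chooseP d b * C ((((Nsos d).choose b : ℝ))⁻¹))

/-- The value of a closed walk as a polynomial. [folklore] -/
def walkP (k : ℕ) (ω : Fin (k + 2) → Idx (Nsos d) (d / 2)) : MvPolynomial (Var d) ℝ :=
  ∏ i : Fin (k + 1), tv d (shrink d ((ω i.castSucc).1 ∪ (ω i.succ).1))

/-- `T_{k+1}` as a polynomial. [folklore] -/
def traceP (k : ℕ) : MvPolynomial (Var d) ℝ :=
  ∑ ω : Fin (k + 2) → Idx (Nsos d) (d / 2),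
    (if ω 0 = ω (Fin.last (k + 1)) then walkP d k ω else 0) *
      weightP d (suppP ω).card (suppL ω).card

/-- The Hankel form as a polynomial in the formula variables and the auxiliary variables `c`.
[folklore] -/
def hankelP : MvPolynomial (Var d ⊕ Fin (K₁ d)) ℝ :=
  ∑ a : Fin (K₁ d), ∑ b : Fin (K₁ d),
    X (Sum.inr a) * X (Sum.inr b) * rename Sum.inl (traceP d (a + b))

variable {d}

/-- Evaluating `C(V(x), a)`. [folklore] -/
theorem aeval_chooseP (a : ℕ) (w : Var d → ℝ) : aeval w (chooseP d a) = chooseR (ordOf d w) a := by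
  rw [chooseP, map_mul, aeval_C, algebraMap_real_apply, chooseR, ← aeval_Vpoly w,
    ← Polynomial.aeval_algHom_apply, Polynomial.coe_aeval_eq_eval]

/-- Evaluating the weight polynomial. [folklore] -/
theorem aeval_weightP (a b : ℕ) (w : Var d → ℝ) :
    aeval w (weightP d a b) = weightR d (ordOf d w) a b := by
  simp only [weightP, weightR, map_mul, aeval_chooseP, aeval_C, algebraMap_real_apply]

/-- Evaluating the walk polynomial. [folklore] -/
theorem aeval_walkP (k : ℕ) (ω : Fin (k + 2) → Idx (Nsos d) (d / 2)) (w : Var d → ℝ) :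
    aeval w (walkP d k ω) = walkVal d (tabOf d w) k ω := by
  simp only [walkP, walkVal, map_prod, aeval_tv]

/-- Evaluating the trace polynomial. [folklore] -/
theorem aeval_traceP (k : ℕ) (w : Var d → ℝ) :
    aeval w (traceP d k) = traceVal d k (ordOf d w) (tabOf d w) := by
  simp only [traceP, traceVal, map_sum, map_mul, aeval_weightP]
  refine sum_congr rfl fun ω _ => ?_
  split_ifs
  · rw [aeval_walkP]
  · rw [map_zero]

/-- Evaluating the Hankel polynomial at `(w, c)`. [folklore] -/
theorem aeval_hankelP (w : Var d → ℝ) (c : Fin (K₁ d) → ℝ) :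
    aeval (Sum.elim w c) (hankelP d) = hankelVal d (ordOf d w) (tabOf d w) c := by
  simp only [hankelP, hankelVal, map_sum, map_mul, aeval_X, Sum.elim_inr, aeval_rename,
    Sum.elim_comp_inl, aeval_traceP]

end Polys

/-! ### Semialgebraicity -/

section SA

variable (d : ℕ)

/-- A set of the form "hypothesis implies a polynomial equation" is semialgebraic. [folklore] -/
theorem isSemialgebraic_setOf_imp_eq {ι : Type*} (P : Prop) (q : MvPolynomial ι ℝ) :
    IsSemialgebraic ℝ {w : ι → ℝ | P → aeval w q = 0} := by
  by_cases hP : P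
  · simp only [hP, forall_true_left]
    exact isSemialgebraic_setOf_eval_eq_zero (R := ℝ) q
  · simp only [hP, IsEmpty.forall_iff, Set.setOf_true]
    exact isSemialgebraic_univ

/-- The points whose table is invariant form a semialgebraic set. [folklore] -/
theorem isSemialgebraic_setOf_tabInv :
    IsSemialgebraic ℝ {w : Var d → ℝ | TabInv (tabOf d w)} := by
  have : {w : Var d → ℝ | TabInv (tabOf d w)} =
      ⋂ q ∈ (univ : Finset (Equiv.Perm (Fin (d + 1)) × Equiv.Perm (Fin (d + 1)) × Tmpl d)),
        {w | True → aeval w (tv d (rel q.1 q.2.1 q.2.2) - tv d q.2.2) = 0} := by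
    ext w
    simp only [TabInv, Set.mem_setOf_eq, Set.mem_iInter, mem_univ, forall_true_left, map_sub,
      aeval_tv, sub_eq_zero, Prod.forall]
  rw [this]
  exact IsSemialgebraic.biInter _ _ fun q _ => isSemialgebraic_setOf_imp_eq _ _

/-- The points satisfying a family of template identities form a semialgebraic set. [folklore] -/
theorem isSemialgebraic_setOf_rowIdentity (col : Bool) (dk k : ℕ) :
    IsSemialgebraic ℝ {w : Var d → ℝ | RowIdentity (d + 1) (Vr (ordOf d w)) dk k
      (rcoef k (ordOf d w)) (fun W => tabOf d w (if col then swapC W else W))} := by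
  have : {w : Var d → ℝ | RowIdentity (d + 1) (Vr (ordOf d w)) dk k (rcoef k (ordOf d w))
      (fun W => tabOf d w (if col then swapC W else W))} =
      ⋂ q ∈ (univ : Finset (Tmpl d × Finset (Fin (d + 1)) × Fin (d + 1))),
        {w | (q.1.card ≤ dk ∧ q.2.1.card = k ∧ q.2.2 ∉ lns q.1) →
          aeval w (idPoly d col k q.1 q.2.1 q.2.2) = 0} := by
    ext w
    simp only [RowIdentity, Set.mem_setOf_eq, Set.mem_iInter, mem_univ, forall_true_left,
      aeval_idPoly, sub_eq_zero, Prod.forall, and_imp]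
  rw [this]
  exact IsSemialgebraic.biInter _ _ fun q _ => isSemialgebraic_setOf_imp_eq _ _

/-- The points satisfying Hankel positivity form a semialgebraic set (a universal block of
coordinates over a polynomial inequality: Tarski–Seidenberg). [BCR 1998, Prop. 2.2.4] [folklore] -/
theorem isSemialgebraic_setOf_hankel :
    IsSemialgebraic ℝ {w : Var d → ℝ | ∀ c : Fin (K₁ d) → ℝ, 0 ≤ hankelVal d (ordOf d w) (tabOf d w) c} := by
  have h := (isSemialgebraic_setOf_eval_nonneg (k := ℝ) (R := ℝ) (hankelP d)).forall_sum_elim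
    (ι := Var d) (κ := Fin (K₁ d))
  convert h using 1
  ext w
  simp only [Set.mem_setOf_eq, aeval_hankelP]

/-- **`W_d` is semialgebraic.** [BCR 1998, §2.1] [folklore] -/
theorem isSemialgebraic_goodSet : IsSemialgebraic ℝ (goodSet d) := by
  have hnorm : IsSemialgebraic ℝ {w : Var d → ℝ | tabOf d w ∅ = 1} := by
    have : {w : Var d → ℝ | tabOf d w ∅ = 1} = {w | aeval w (tv d ∅ - 1) = 0} := by
      ext w; simp only [Set.mem_setOf_eq, map_sub, map_one, aeval_tv, sub_eq_zero]
    rw [this]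
    exact isSemialgebraic_setOf_eval_eq_zero (R := ℝ) _
  have h1 := isSemialgebraic_setOf_rowIdentity d false (d - 1) 1
  have h2 := isSemialgebraic_setOf_rowIdentity d false (d - 2) 2
  have h3 := isSemialgebraic_setOf_rowIdentity d true (d - 1) 1
  have h4 := isSemialgebraic_setOf_rowIdentity d true (d - 2) 2
  simp only [Bool.false_eq_true, if_false, if_true] at h1 h2 h3 h4
  have h := ((((((isSemialgebraic_setOf_tabInv d).inter hnorm).inter h1).inter h2).inter h3).inter
    h4).inter (isSemialgebraic_setOf_hankel d)
  convert h using 1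
  ext w
  simp only [goodSet, GoodPt, Set.mem_setOf_eq, Set.mem_inter_iff, and_assoc]

/-- **`F_d` is semialgebraic** (projection: Tarski–Seidenberg). [BCR 1998, Thm. 2.2.1] [folklore] -/
theorem isSemialgebraic_feasSet : IsSemialgebraic ℝ (feasSet d) :=
  (isSemialgebraic_goodSet d).exists_sum_elim

end SA

/-! ### Semialgebraic subsets of the line are eventually constant -/

section Line

/-- A polynomial in one `Unit`-indexed variable is a univariate polynomial function. [folklore] -/
theorem exists_polynomial_eval_eq (q : MvPolynomial Unit ℝ) :
    ∃ P : Polynomial ℝ, ∀ t : ℝ, aeval (fun _ : Unit => t) q = P.eval t := by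
  refine ⟨aeval (fun _ : Unit => (Polynomial.X : Polynomial ℝ)) q, fun t => ?_⟩
  rw [← Polynomial.coe_aeval_eq_eval, ← AlgHom.comp_apply, MvPolynomial.comp_aeval]
  congr 2
  funext u
  simp

/-- The sign of a real polynomial function is eventually constant at `+∞`. [folklore] -/
theorem eventually_sign_const (P : Polynomial ℝ) :
    ∃ (N : ℝ) (σ : SignType), ∀ t, N ≤ t → SignType.sign (P.eval t) = σ := by
  by_cases hdeg : 0 < P.degree
  · rcases le_or_gt 0 P.leadingCoeff with hlc | hlc
    · obtain ⟨N, hN⟩ := Filter.tendsto_atTop_atTop.1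
        (P.tendsto_atTop_of_leadingCoeff_nonneg hdeg hlc) 1
      exact ⟨N, 1, fun t ht => sign_eq_one_iff.2 (lt_of_lt_of_le one_pos (hN t ht))⟩
    · obtain ⟨N, hN⟩ := Filter.tendsto_atTop_atBot.1
        (P.tendsto_atBot_of_leadingCoeff_nonpos hdeg hlc.le) (-1)
      exact ⟨N, -1, fun t ht => sign_eq_neg_one_iff.2 (lt_of_le_of_lt (hN t ht) (by norm_num))⟩
  · rw [not_lt] at hdeg
    obtain ⟨c, hc⟩ : ∃ c, P = Polynomial.C c := ⟨_, Polynomial.eq_C_of_degree_le_zero hdeg⟩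
    exact ⟨0, SignType.sign c, fun t _ => by rw [hc, Polynomial.eval_C]⟩

/-- **A semialgebraic subset of the real line is eventually constant**: beyond some point either
all or no `t` belong to it. [BCR 1998, Prop. 2.1.7] [folklore] -/
theorem eventually_const_of_isSemialgebraic {s : Set (Unit → ℝ)} (hs : IsSemialgebraic ℝ s) :
    ∃ N : ℝ, (∀ t, N ≤ t → (fun _ => t) ∈ s) ∨ (∀ t, N ≤ t → (fun _ => t) ∉ s) := by
  classical
  obtain ⟨Q, T, rfl⟩ := hs.exists_eq_setOf_signVec_mem
  -- eventual sign of each of the finitely many polynomials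
  have hq : ∀ q : Q, ∃ (N : ℝ) (σ : SignType), ∀ t, N ≤ t →
      SignType.sign (aeval (fun _ : Unit => t) (q : MvPolynomial Unit ℝ)) = σ := by
    intro q
    obtain ⟨P, hP⟩ := exists_polynomial_eval_eq (q : MvPolynomial Unit ℝ)
    obtain ⟨N, σ, hN⟩ := eventually_sign_const P
    exact ⟨N, σ, fun t ht => by rw [hP]; exact hN t ht⟩
  choose Nq σq hNq using hq
  refine ⟨∑ q : Q, |Nq q|, ?_⟩
  have hle : ∀ q : Q, Nq q ≤ ∑ q' : Q, |Nq q'| := fun q =>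
    (le_abs_self _).trans (single_le_sum (f := fun q' => |Nq q'|) (fun _ _ => abs_nonneg _)
      (mem_univ q))
  have hvec : ∀ t, ∑ q : Q, |Nq q| ≤ t →
      (fun q : Q => SignType.sign (aeval (fun _ : Unit => t) (q : MvPolynomial Unit ℝ))) = σq := by
    intro t ht
    funext q
    exact hNq q t ((hle q).trans ht)
  by_cases hT : σq ∈ T
  · left
    intro t ht
    simp only [Set.mem_setOf_eq, hvec t ht]
    exact hT
  · right
    intro t ht
    simp only [Set.mem_setOf_eq, hvec t ht]
    exact hT

/-- **Transfer along the primes.** If a semialgebraic subset of the line contains `p` for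
infinitely many primes `p` (as the constant function), it contains every sufficiently large real.
[folklore] -/
theorem eventually_mem_of_primes {s : Set (Unit → ℝ)} (hs : IsSemialgebraic ℝ s)
    (hp : ∀ n₀ : ℕ, ∃ p : ℕ, n₀ ≤ p ∧ p.Prime ∧ (fun _ => (p : ℝ)) ∈ s) :
    ∃ N : ℝ, ∀ t, N ≤ t → (fun _ => t) ∈ s := by
  obtain ⟨N, h | h⟩ := eventually_const_of_isSemialgebraic hs
  · exact ⟨N, h⟩
  · exfalso
    obtain ⟨p, hp₀, -, hps⟩ := hp (⌈N⌉₊ + 1)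
    refine h p ?_ hps
    have : (⌈N⌉₊ : ℝ) + 1 ≤ p := by exact_mod_cast hp₀
    linarith [Nat.le_ceil N]

end Line

end Summit.PneNP.PneNP.Theorems.SosBlindPlanes
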